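import Summits.BirchSwinnertonDyer.BirchSwinnertonDyer.Theorems.ByReductionTypeAtTwoSupersingularFlatRoadContra
import Summits.BirchSwinnertonDyer.BirchSwinnertonDyer.Theorems.ByReductionTypeAtTwoSupersingularBlindPinchBlindZeroOfTwistSelmerCorank
import Summits.BirchSwinnertonDyer.BirchSwinnertonDyer.Theorems.AlignedTransportAtTwoMainConjectureOfRankZeroBSDAtTwoTwinValueAlgebra
import Summits.BirchSwinnertonDyer.BirchSwinnertonDyer.Theorems.AlignedTransportAtTwoMainConjectureOfRankZeroBSDAtTwoTwinValueParity
import HarnessLib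

/-!
# Route `ByReductionTypeAtTwo` (rung K4), crux `SupersingularRankZeroAtTwo` (item stmt-BirchSwinnertonDyer-19097), line `odd_blind_package`:
# **ROAD-CONTRA, part 2 — the `ι`-GLUE for §7's two kernels under the v2.18 (R1) keying, and EC♭ / K87-C AT KEY `γ⁻¹`**
# (cell `bsd-2adic`, LEAD ss-1 GEN 25; director (905)(b)(i) «(K3) + (k1)»; `--supports 19097`, helper)

WHY.  Under (R1) the ♭ road (ROAD-CONTRA part 1, ★★ p831246) delivers, for the key-`γ⁻¹` (print) ♭ dual datum `D′ = X♭_std`, `char D′ = (ξ′)` and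
`ι₂(ξ′·h) = C(ϖ)·ι₂ L♭` (so `ξ′ ∣ G` for THE avatar `G`), whereas the line's blind-character machinery — EC♭ (★ `SSFlatRoad.flatEulerChar_two`), K87-C
(★★ p827897 `BlindPinch.blindZeroOfTwistSelmerCorankAtTwo`), CDC_H, NF♭_H, hA — is typed for the key-`γ` datum `D_γ = (X♭_std)^ι`.  Everything those
consumers read is `ι`-INVARIANT: the constant term (`IwasawaAlgebra.constantCoeff_invol`: `T = 0` is `ι`-fixed), the value at `T = −2` (★
`AlignedTransportAtTwoTwinValueAlgebra.evalAt_neg_two_invol`: the second `ι`-fixed point at `p = 2`), divisibility by the blind prime `T + 2`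
(`ι(T+2) = (T+2)·(1+T)⁻¹`, this file), `μ` and `λ` (`mu_invol` here, ★ `…TwinValueParity.lam_invol`).  This file lands the glue lemmas and the two
key-`γ⁻¹` readings the v2.18 kernels `bsdp_two_of_genericOdd` / `bsdp_two_of_twistPinch` call BY NAME.

WHAT (theorems only; no definition, no named fact, no instance, no `sorry`; axioms the standard trio):
* §1 `Λ`-algebra at `2`: `isUnit_one_add_X`, `invol_X_add_C_two_mul_one_add_X` (`ι(T+2)·(1+T) = T+2`), ★ `X_add_C_two_dvd_invol_iff`
  (`(T+2) ∣ ι f ↔ (T+2) ∣ f`), `mu_invol` (`μ(ι g) = μ(g)`, any `p`).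
* §2 ★ `flatEulerChar_two_contra` — EC♭ AT KEY `γ⁻¹`: `flatEulerChar_two`'s binders VERBATIM except `D : SharpFlatSelmerDualData W κ γ⁻¹ …`; same conclusion
  (`ξ′(0) = u·2^{v₂ Tam}·#Sel_{2^∞}(E/ℚ)`) — via a key-`γ` twin `D`, `char D = (ι ξ′)` (`sharpFlatSelmerDualData_charIdeal_eq_span_invol`) and `(ι ξ′)(0) = ξ′(0)`.
* §3 ★ `blindZeroOfTwistSelmerCorankAtTwo_contra` — K87-C AT KEY `γ⁻¹`: `corank Sel_{2^∞}(E^{(2)}/ℚ) ≥ 2 ⟹ (T+2) ∣ char X♭_std` — K87-C on the key-`γ` twin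
  gives `(T+2) ∣ ι ξ′`, and §1 removes the `ι`.
HONEST FRAMING: helper lemmas; close NO registered stub; 19097 OPEN on 5 registered stubs (v2.17 b90024f4); the crux and BSD are NOT proved; BSD is
proved for no curve.  References: [Greenberg1989, §0 pp. 101–102] [GreenbergLNM1716, §1 p. 60, Prop. 3.10] [MazurTateTeitelbaum1986Invent, Ch. I §17]
[Washington1997, §7.1, §13.2] [Sprung2012, Def. 7.11, Thm. 7.14] [Sprung2024, §5.2 Lemmas 5.5–5.9].  bears_on: stmt-BirchSwinnertonDyer-19097 (v2.18 R1).
-/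

set_option autoImplicit false
set_option linter.dupNamespace false

noncomputable section

open scoped Classical MatrixGroups ModularForm NumberField
open NumberField IsDedekindDomain CongruenceSubgroup WeierstrassCurve Literature.NumberTheory.EllipticCurves
  Literature.NumberTheory.EllipticCurves.ModularForms Literature.NumberTheory.EllipticCurves.Sprung2017
  Literature.NumberTheory.EllipticCurves.Sprung2012
  Literature.NumberTheory.EllipticCurves.Rank1Residual Literature.NumberTheory.EllipticCurves.Rank1Residual.Typed
  Literature.NumberTheory.EllipticCurves.Kobayashi2003 Literature.NumberTheory.EllipticCurves.IwasawaDual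
  Literature.NumberTheory.EllipticCurves.IwasawaAlgebra
  Literature.NumberTheory.GaloisRepresentations
  ZpExtension Summit.BirchSwinnertonDyer.Rank1Residual Summit.BirchSwinnertonDyer.Rank1Residual.Supersingular
  Summit.BirchSwinnertonDyer.Rank1Residual.X5.O1

universe u

namespace Summit.BirchSwinnertonDyer.BirchSwinnertonDyer.Theorems.SSFlatRoad

/-! ## §1 `Λ`-algebra at `2`: the blind prime `T + 2` and `μ` are `ι`-invariant -/

section Algebra

/-- `1 + T` is a unit of `Λ = ℤ_p⟦T⟧` (its constant term is `1`). [cite: Washington1997, §7.1] -/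
theorem isUnit_one_add_X {p : ℕ} [Fact p.Prime] : IsUnit (1 + PowerSeries.X : IwasawaAlgebra p) := by
  rw [PowerSeries.isUnit_iff_constantCoeff]
  simp

/-- **`ι(T + 2)·(1 + T) = T + 2`** in `ℤ₂⟦T⟧`: the blind prime `T + 2` (the order-`2` character, `γ ↦ −1`) is `ι`-stable up to the unit `1 + T`
(`ι T · (1+T) = −T`, tree `invol_X_mul_one_add_X`). [cite: MazurTateTeitelbaum1986Invent, Ch. I §17] [cite: GreenbergLNM1716, Prop. 3.10 (p. 98)] -/
theorem invol_X_add_C_two_mul_one_add_X :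
    invol 2 (PowerSeries.X + PowerSeries.C (2 : ℤ_[2])) * (1 + PowerSeries.X) =
      (PowerSeries.X + PowerSeries.C (2 : ℤ_[2]) : IwasawaAlgebra 2) := by
  have h2 : (PowerSeries.C (2 : ℤ_[2]) : IwasawaAlgebra 2) = 2 := by
    rw [show (2 : ℤ_[2]) = ((2 : ℕ) : ℤ_[2]) by norm_num, map_natCast]; norm_num
  rw [map_add, invol_C, add_mul, invol_X_mul_one_add_X, h2]
  ring

/-- ★ **`(T + 2) ∣ ι f ↔ (T + 2) ∣ f`**: divisibility by the blind prime is `ι`-invariant (`ι` is an involutive ring automorphism and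
`ι(T+2) = (T+2)·(1+T)⁻¹`). [cite: GreenbergLNM1716, Prop. 3.10 (p. 98)] [cite: Washington1997, §13.2] -/
theorem X_add_C_two_dvd_invol_iff (f : IwasawaAlgebra 2) :
    (PowerSeries.X + PowerSeries.C (2 : ℤ_[2]) : IwasawaAlgebra 2) ∣ invol 2 f ↔
      (PowerSeries.X + PowerSeries.C (2 : ℤ_[2]) : IwasawaAlgebra 2) ∣ f := by
  obtain ⟨u, hu⟩ := (isUnit_one_add_X (p := 2))
  -- `ι(T+2) = (T+2) · u⁻¹`
  have hmul : invol 2 (PowerSeries.X + PowerSeries.C (2 : ℤ_[2])) * ↑u =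
      (PowerSeries.X + PowerSeries.C (2 : ℤ_[2]) : IwasawaAlgebra 2) := by
    rw [hu]; exact invol_X_add_C_two_mul_one_add_X
  have hι : invol 2 (PowerSeries.X + PowerSeries.C (2 : ℤ_[2])) =
      (PowerSeries.X + PowerSeries.C (2 : ℤ_[2]) : IwasawaAlgebra 2) * ↑u⁻¹ := by
    calc invol 2 (PowerSeries.X + PowerSeries.C (2 : ℤ_[2]))
        = invol 2 (PowerSeries.X + PowerSeries.C (2 : ℤ_[2])) * ↑u * ↑u⁻¹ := (Units.mul_inv_cancel_right _ _).symm
      _ = (PowerSeries.X + PowerSeries.C (2 : ℤ_[2]) : IwasawaAlgebra 2) * ↑u⁻¹ := by rw [hmul]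
  -- one direction suffices, applied to `f` and to `ι f`
  have key : ∀ h : IwasawaAlgebra 2, (PowerSeries.X + PowerSeries.C (2 : ℤ_[2]) : IwasawaAlgebra 2) ∣ invol 2 h →
      (PowerSeries.X + PowerSeries.C (2 : ℤ_[2]) : IwasawaAlgebra 2) ∣ h := by
    intro h ⟨q, hq⟩
    refine ⟨↑u⁻¹ * invol 2 q, ?_⟩
    rw [← invol_invol 2 h, hq, map_mul, hι, mul_assoc]
  refine ⟨key f, fun hf ↦ key (invol 2 f) ?_⟩
  rwa [invol_invol]

/-- **`μ(ι g) = μ(g)`**: `ι` fixes the constants `C(p^n)` and is an automorphism, so `p^n ∣ ι g ↔ p^n ∣ g`. [cite: Washington1997, §13.2] -/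
theorem mu_invol {p : ℕ} [Fact p.Prime] (g : IwasawaAlgebra p) :
    Summit.BirchSwinnertonDyer.Rank1Residual.X1.MuLambda.mu (invol p g) = Summit.BirchSwinnertonDyer.Rank1Residual.X1.MuLambda.mu g := by
  unfold Summit.BirchSwinnertonDyer.Rank1Residual.X1.MuLambda.mu
  congr 1
  ext n
  simp only [Set.mem_setOf_eq]
  constructor
  · intro h
    have h' := map_dvd (invol p) h
    rwa [invol_C, invol_invol] at h'
  · intro h
    have h' := map_dvd (invol p) h
    rwa [invol_C] at h'

end Algebra

/-! ## §2–§3 EC♭ and K87-C at key `γ⁻¹` -/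

section AtTwo

variable (W : WeierstrassCurve ℚ) [W.IsElliptic] [W.IsGloballyMinimal]

/-- ★ **EC♭ at `2`, CONTRAGREDIENT KEYING**: `SSFlatRoad.flatEulerChar_two` (Sprung 2024 Lemmas 5.5/5.8/5.9 read at `2`: `ξ(0) = u·2^{v₂ Tam}·#Sel_{2^∞}(E/ℚ)`
for a characteristic power series `ξ` of `X♭`, `Sel` finite) for the key-`γ⁻¹` (print) datum `D′`: binders verbatim except the key; proof = the key-`γ`
theorem on a key-`γ` twin `D` (`nonempty_sharpFlatSelmerDualData … hγ`), whose characteristic ideal is `(ι ξ′)` (`sharpFlatSelmerDualData_charIdeal_eq_span_invol`),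
and `(ι ξ′)(0) = ξ′(0)` (`IwasawaAlgebra.constantCoeff_invol`). [cite: Sprung2024, §5.2 Lemmas 5.5, 5.8, 5.9] [cite: Greenberg1989, §0 pp. 101–102] -/
theorem flatEulerChar_two_contra (hss : GoodSS W 2)
    (κ : ZpExtension ℚ 2) {γ : Field.absoluteGaloisGroup ℚ} (hγ : κ.IsTopGenerator γ)
    {v : HeightOneSpectrum (𝓞 ℚ)} (hv : (2 : 𝓞 ℚ) ∈ v.asIdeal)
    {g : Field.absoluteGaloisGroup (v.adicCompletion ℚ)}
    (hg : κ.IsTopGenerator (resGalOfEmb (closureEmb (K := ℚ) (v.adicCompletion ℚ)) g))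
    {c : ℕ → localPoints W (v.adicCompletion ℚ)}
    (hc : ∀ n, c n ∈ localLayerPointsOfEmb κ (closureEmb (K := ℚ) (v.adicCompletion ℚ)) W n)
    (hTr : ∀ n, 1 ≤ n → localTraceOfEmb κ (closureEmb (K := ℚ) (v.adicCompletion ℚ)) W n (n + 1)
      (c (n + 1)) = W.frobeniusTrace 2 • c n - c (n - 1))
    (hinj : ∀ z₀ : localLayerPointsOfEmb κ (closureEmb (K := ℚ) (v.adicCompletion ℚ)) W 0 →+ ℤ_[2],
      evalOn W (localLayerPointsOfEmb κ (closureEmb (K := ℚ) (v.adicCompletion ℚ)) W 0) z₀ (c 0) = 0 →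
        z₀ = 0)
    (hsat : ∀ a : ℤ_[2],
      (∃ z₀ : localLayerPointsOfEmb κ (closureEmb (K := ℚ) (v.adicCompletion ℚ)) W 0 →+ ℤ_[2],
        evalOn W (localLayerPointsOfEmb κ (closureEmb (K := ℚ) (v.adicCompletion ℚ)) W 0) z₀ (c 0) =
          2 * a) →
      ∃ y : localLayerPointsOfEmb κ (closureEmb (K := ℚ) (v.adicCompletion ℚ)) W 0 →+ ℤ_[2],
        evalOn W (localLayerPointsOfEmb κ (closureEmb (K := ℚ) (v.adicCompletion ℚ)) W 0) y (c 0) = a)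
    (hcount : Finite (W.selmerGroupPInfty 2) →
      Finite (EndCoinvariants (conjSharpFlatSelmerInfty W κ (closureEmb (K := ℚ) (v.adicCompletion ℚ))
        (W.frobeniusTrace 2) g c .flat γ - 1)) →
      Nat.card (↥((sharpFlatSelmerInfty W κ (closureEmb (K := ℚ) (v.adicCompletion ℚ))
            (W.frobeniusTrace 2) g c .flat).comap (W.layerToInfty κ 0)) ⧸
          (W.selmerLayer κ 0).addSubgroupOf
            ((sharpFlatSelmerInfty W κ (closureEmb (K := ℚ) (v.adicCompletion ℚ))
              (W.frobeniusTrace 2) g c .flat).comap (W.layerToInfty κ 0))) *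
        Nat.card (MulAction.fixedPoints (Field.absoluteGaloisGroup ℚ) (W.geomPrimaryTorsion 2)) =
      2 ^ (padicValNat 2 W.tamagawaProduct) *
        Nat.card (EndCoinvariants (conjSharpFlatSelmerInfty W κ
          (closureEmb (K := ℚ) (v.adicCompletion ℚ)) (W.frobeniusTrace 2) g c .flat γ - 1)))
    (D' : SharpFlatSelmerDualData W κ γ⁻¹ (closureEmb (K := ℚ) (v.adicCompletion ℚ))
      (W.frobeniusTrace 2) g c .flat)
    (hX' : Module.IsTorsion (IwasawaAlgebra 2) D'.X) (f : IwasawaAlgebra 2) (hf : D'.charIdeal = Ideal.span {f})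
    (hfin : Finite (W.selmerGroupPInfty 2)) :
    ∃ u : ℤ_[2]ˣ, ((PowerSeries.constantCoeff f : ℤ_[2]) : ℚ_[2]) =
      ((u : ℤ_[2]) : ℚ_[2]) * ((2 : ℕ) : ℚ_[2]) ^ (padicValNat 2 W.tamagawaProduct) *
        (Nat.card (W.selmerGroupPInfty 2) : ℚ_[2]) := by
  obtain ⟨D⟩ := nonempty_sharpFlatSelmerDualData W κ (closureEmb (K := ℚ) (v.adicCompletion ℚ))
    (W.frobeniusTrace 2) g c Chroma.flat hγ
  haveI : Module.Finite (IwasawaAlgebra 2) D.X := D.moduleFinite hγ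
  have hX : Module.IsTorsion (IwasawaAlgebra 2) D.X := (sharpFlatSelmerDualData_isTorsion_inv_iff D D').2 hX'
  have hchar : D.charIdeal = Ideal.span {invol 2 f} := sharpFlatSelmerDualData_charIdeal_eq_span_invol W κ D D' hf
  obtain ⟨u, hu⟩ := flatEulerChar_two W hss κ hγ hv hg hc hTr hinj hsat hcount D hX (invol 2 f) hchar hfin
  exact ⟨u, by rw [← hu, constantCoeff_invol]⟩

/-- ★ **K87-C at `2`, CONTRAGREDIENT KEYING** (the (k1) helper of director (904)(b)/(905)(b)): for the key-`γ⁻¹` (print) ♭ dual datum `D′` (torsion,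
`char = (ξ′)`; finite generation is the tree theorem `SharpFlatSelmerDualData.moduleFinite` on the key-`γ` twin) and every `ℚ`-model `W₂ ≅ E^{(2)}` with `corank_{ℤ₂} Sel_{2^∞}(W₂/ℚ) ≥ 2`: **`(T + 2) ∣ ξ′`**.  K87-C (★★ p827897) on a key-`γ` twin `D` gives
`(T+2) ∣ ι ξ′` (`char D = (ι ξ′)`), and `X_add_C_two_dvd_invol_iff` removes the `ι`. [cite: Sprung2012, Def. 7.11, Thm. 7.14]
[cite: GreenbergLNM1716, §1 p. 60, Prop. 3.10] [cite: Greenberg1989, §0 pp. 101–102] -/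
theorem blindZeroOfTwistSelmerCorankAtTwo_contra (hss : GoodSS W 2)
    (κ : ZpExtension ℚ 2) (γ : Field.absoluteGaloisGroup ℚ)
    (hκ : κ.IsCyclotomic) (hγ : κ.IsTopGenerator γ) (hγ' : IsCyclotomicVariable 2 γ)
    (v : HeightOneSpectrum (𝓞 ℚ)) (hv : (2 : 𝓞 ℚ) ∈ v.asIdeal)
    (g : Field.absoluteGaloisGroup (v.adicCompletion ℚ)) (c : ℕ → localPoints W (v.adicCompletion ℚ)) (col : Chroma)
    (D' : SharpFlatSelmerDualData W κ γ⁻¹ (closureEmb (K := ℚ) (v.adicCompletion ℚ)) (W.frobeniusTrace 2) g c col)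
    (hX' : Module.IsTorsion (IwasawaAlgebra 2) D'.X)
    (ξ : IwasawaAlgebra 2) (hξ : D'.charIdeal = Ideal.span {ξ})
    (W₂ : WeierstrassCurve ℚ) [W₂.IsElliptic]
    (htw : ∃ C : WeierstrassCurve.VariableChange ℚ, C • W.quadraticTwist 2 = W₂) (h2 : 2 ≤ W₂.selmerCorank 2) :
    (PowerSeries.X + PowerSeries.C (2 : ℤ_[2]) : IwasawaAlgebra 2) ∣ ξ := by
  obtain ⟨D⟩ := nonempty_sharpFlatSelmerDualData W κ (closureEmb (K := ℚ) (v.adicCompletion ℚ))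
    (W.frobeniusTrace 2) g c col hγ
  haveI : Module.Finite (IwasawaAlgebra 2) D.X := D.moduleFinite hγ
  have hX : Module.IsTorsion (IwasawaAlgebra 2) D.X := (sharpFlatSelmerDualData_isTorsion_inv_iff D D').2 hX'
  have hchar : D.charIdeal = Ideal.span {invol 2 ξ} := sharpFlatSelmerDualData_charIdeal_eq_span_invol W κ D D' hξ
  have h := BlindPinch.blindZeroOfTwistSelmerCorankAtTwo W hss κ γ hκ hγ hγ' v hv g c col D hX (invol 2 ξ) hchar W₂ htw h2
  exact (X_add_C_two_dvd_invol_iff ξ).1 h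

end AtTwo

end Summit.BirchSwinnertonDyer.BirchSwinnertonDyer.Theorems.SSFlatRoad

end
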